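import Summits.HodgeConjecture.HodgeConjecture.Theses.SecondaryPeriods
import Summits.HodgeConjecture.HodgeConjecture.Theorems.SecondaryPeriodsRiemannWeightOneStubSiegelForm
import Summits.HodgeConjecture.HodgeConjecture.Theorems.SecondaryPeriodsRiemannWeightOneStubTransfer
import Summits.HodgeConjecture.HodgeConjecture.Theorems.SecondaryPeriodsRiemannWeightOneStubTorusCohomologyBasis
import Summits.HodgeConjecture.HodgeConjecture.Theorems.SecondaryPeriodsRiemannWeightOneStubImageAnalytic
import Summits.HodgeConjecture.HodgeConjecture.Theorems.SecondaryPeriodsRiemannWeightOneStubAlgebraisation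
import Summits.HodgeConjecture.HodgeConjecture.Theorems.SecondaryPeriodsRiemannWeightOneStubAlgebraisationSmooth
import Literature.AlgebraicGeometry.HodgeTheory.WeightOneHodgeStructuresOfTori
import Literature.AlgebraicGeometry.Motives.ChowConeChow
import Literature.Geometry.Symplectic.GromovR4RelEndProofs
import Literature.NumberTheory.Transcendental.AnalytificationProjProofs
import Literature.NumberTheory.Transcendental.ProjectiveSpaceProofs
import Literature.NumberTheory.Transcendental.ProjectiveSpaceT2Proofs
import Literature.Analysis.SpecialFunctions.RiemannThetaLefschetzSteps
import Literature.Geometry.Kaehler.SiegelTorusThetaEmbedding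

/-!
# Line `birth` (v2, reshaped) — skeleton for crux `RiemannWeightOne` (stmt-HodgeConjecture-16406)

Route `SecondaryPeriods`, crux #6 `RiemannWeightOne` = the Literature named fact
`HodgeTheory.weightOne_polarizable_eq_range_of_smoothProjective` (Riemann's theorem, geometric form:
every finite-dimensional polarisable effective weight-one `ℚ`-Hodge structure is a Hodge quotient of
`H¹(X(ℂ); ℚ)` of a smooth projective `X/ℂ`).

## Why the reshape

Of the three birth stubs, `stub_complexStructure` and `stub_torusCohomology` are Literature THEOREMS
(`exists_cx_riemannForm_hom_of_isPolarizable`, `weightOne_torusCohomology_of_isAnalytification`), so the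
birth line had collapsed onto its one XL stub `stub_lefschetz` (every polarised complex torus
`ℂⁿ/Φ(ℤ^ι)` is the analytification of a smooth projective variety: Lefschetz + Chow + GAGA). This
file cuts `stub_lefschetz` along the printed proof AND uses the freedom the crux leaves (we choose the
lattice): a SYMPLECTIC `ℚ`-basis of `(V, E)` (`Literature.Geometry.Symplectic.exists_symplecticBasis`,
in the tree) makes the polarisation PRINCIPAL and puts the torus in SIEGEL NORMAL FORM
`ℂⁿ/(ℤⁿ ⊕ Ωℤⁿ)`, `Ω ∈ 𝔥ₙ`, where Lefschetz's theorem is the classical theta embedding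
(`Literature.Analysis.SpecialFunctions.riemannTheta` is in the tree: convergence, quasi-periodicity,
holomorphy). Chow's theorem is PROVED in the tree (`Motives.isProjAlgebraicSet_of_isAnalyticSet_holds`).

## Registered stubs (7)

1. `stub_siegelForm` [M] — Siegel normal form of `(V_ℝ, J, E)` in a symplectic basis (LB §8.1, Lemma 8.1? /
   Birkenhake–Lange Prop. 8.1.1): the `inl`-half of the basis is a `ℂ`-basis of `(V_ℝ, J)`; the
   `inr`-half has symmetric coordinates `Ω` with `Im Ω` positive definite.
2. `stub_thetaEmbedding` [XL, HARDEST] — Lefschetz: the torus `ℂⁿ/(ℤⁿ ⊕ Ωℤⁿ)`, `Ω ∈ 𝔥ₙ`, admits an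
   injective holomorphic immersion into some `ℙᴺ(ℂ)` (theta functions of level 3; Mumford, Tata I,
   Ch. II §1; Lange–Birkenhake Thm. 4.5.1).
3. `stub_imageAnalytic` [M] — the image of a compact complex manifold under an injective holomorphic
   immersion into `ℙᴺ(ℂ)` is an analytic subset (Chirka §2; GH Ch. 0 §2).
4. `stub_algebraisation` [L] — a projective algebraic set which is the injective holomorphic image of a
   compact complex manifold `M` carries the reduced closed subscheme `X ⊆ ℙᴺ_ℂ`, and `M → X(ℂ)` is an
   analytification (Serre GAGA §2 n°5: regular functions are locally restrictions from `ℙᴺ`).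
5. `stub_algebraisationSmooth` [L–XL] — that `X` is smooth projective geometrically irreducible of
   dimension `n` when `M` is connected and the map an immersion (Serre GAGA §2 n°6–8; Chow 1949).
6. `stub_transfer` [M] — `IsAnalytification` of a torus is invariant under a change of period
   isomorphism with `ℂ`-linear transition (LB §1.1.2).
7. `stub_torusCohomologyBasis` [M] — `weightOne_torusCohomology_of_isAnalytification` for an ARBITRARY
   `ℚ`-basis of `V` (the Literature theorem hard-wires `Module.finBasis`).

PROVED here: the composition `riemannWeightOne_of_stubs` and `RiemannWeightOne_of` (the crux BY NAME).

STATUS 2026-08-17T13:05Z: ALL STUBS LANDED — the six Summit-side stub files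
`Theorems/SecondaryPeriodsRiemannWeightOneStub*.lean` and, for the theta embedding, the Literature theorems
`Analysis.SpecialFunctions.riemannTheta_not_identically_zero/_cubic_separatesPoints/_cubic_separatesTangents`
(RiemannThetaLefschetzSteps) and `Geometry.Kaehler.siegelTorus_thetaEmbedding` (Lefschetz, level-three thetas).
The crux is CLOSED (`proved`) by `Summit.HodgeConjecture.HodgeConjecture.Theorems.riemannWeightOne_proof`
(Theorems/SecondaryPeriodsRiemannWeightOne.lean, p162080, commit 3c08c26b). This workfile is now sorry-free.
-/

set_option linter.dupNamespace false

noncomputable section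

namespace Summit.HodgeConjecture.HodgeConjecture.Cruxes.RiemannWeightOne.Birth

open scoped TensorProduct Manifold ContDiff LinearAlgebra.Projectivization
open CategoryTheory AlgebraicGeometry
open Literature.AlgebraicGeometry.Motives
open Literature.AlgebraicGeometry.Motives.HodgeStructure
open Literature.AlgebraicGeometry.HodgeTheory (HodgeModel)
open Literature.Geometry.Kaehler (ComplexTorus CxModule IsAnalyticSet)
open Literature.NumberTheory.Transcendental (IsAnalytification IsProjAlgebraicSet projPoint)
open Literature.Analysis.SpecialFunctions (riemannTheta)

/-! ## The seven registered stubs -/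

/-- **stub_siegelForm** [M]. Siegel normal form. `J` a complex structure on `V_ℝ = ℝ ⊗_ℚ V`, `E` a
rational alternating form with the Riemann relations `E_ℝ(Ja, Jc) = E_ℝ(a, c)`, `E_ℝ(a, Ja) > 0`
(`a ≠ 0`), and `b` a symplectic basis of `(V, E)` indexed by `Fin n ⊕ Fin n`
(`E(b₁ᵢ, b₁ⱼ) = E(b₂ᵢ, b₂ⱼ) = 0`, `E(b₁ᵢ, b₂ⱼ) = δᵢⱼ`, `b₁ = b ∘ inl`, `b₂ = b ∘ inr`). Then the
`1 ⊗ b₁ᵢ` form a `ℂ`-basis of `(V_ℝ, J)`: there is a real-linear isomorphism `Ψ : V_ℝ ≃ ℂⁿ` with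
`Ψ(Ja) = iΨ(a)` and `Ψ(1 ⊗ b₁ᵢ) = eᵢ`, and the coordinates `Ω` of the other half,
`Ψ(1 ⊗ b₂ⱼ) = (Ωᵢⱼ)ᵢ`, form a symmetric matrix with `Im Ω` positive definite (proof: `U = ⟨b₁⟩_ℝ` is
`E`-isotropic so `U ∩ JU = 0`; with `S = (E_ℝ(b₁ᵢ, J b₁ₗ))` symmetric positive definite one finds
`Im Ω = S⁻¹`, `Re Ω` symmetric from `E(b₂, b₂) = 0`). Lange–Birkenhake 1992 §8.1 (PDF p. 231 ff.),
Birkenhake–Lange 2004 Prop. 8.1.1; Mumford AV §1–2. -/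
theorem stub_siegelForm :
    ∀ ⦃V : Type⦄ [AddCommGroup V] [Module ℚ V] [Module.Finite ℚ V]
      (J : ℝ ⊗[ℚ] V →ₗ[ℝ] ℝ ⊗[ℚ] V) (_hJ : ∀ a, J (J a) = -a) (E : LinearMap.BilinForm ℚ V),
      (∀ x y, E y x = -E x y) → (∀ a c, E.baseChange ℝ (J a) (J c) = E.baseChange ℝ a c) →
      (∀ a, a ≠ 0 → 0 < E.baseChange ℝ a (J a)) →
      ∀ ⦃n : ℕ⦄ (b : Module.Basis (Fin n ⊕ Fin n) ℚ V),
      (∀ i j, E (b (Sum.inl i)) (b (Sum.inl j)) = 0) →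
      (∀ i j, E (b (Sum.inr i)) (b (Sum.inr j)) = 0) →
      (∀ i j, E (b (Sum.inl i)) (b (Sum.inr j)) = if i = j then 1 else 0) →
      ∃ (Ψ : ℝ ⊗[ℚ] V ≃ₗ[ℝ] (Fin n → ℂ)) (Ω : Matrix (Fin n) (Fin n) ℂ),
        (∀ a, Ψ (J a) = Complex.I • Ψ a) ∧
        (∀ i j, Ω i j = Ω j i) ∧
        (Matrix.of fun i j => (Ω i j).im).PosDef ∧
        (∀ i, Ψ ((1 : ℝ) ⊗ₜ[ℚ] b (Sum.inl i)) = Pi.single i 1) ∧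
        (∀ j, Ψ ((1 : ℝ) ⊗ₜ[ℚ] b (Sum.inr j)) = fun i => Ω i j) :=
  _root_.Summit.HodgeConjecture.HodgeConjecture.Theorems.RiemannWeightOne.stub_siegelForm

/-! ### The theta embedding (Lefschetz), cut into four stubs

Throughout `ϑ = riemannTheta Ω` (`Literature.Analysis.SpecialFunctions.riemannTheta`: the classical
Riemann theta function `ϑ(z, Ω) = Σ_m exp(πi ᵗmΩm + 2πi ᵗmz)` of `Ω ∈ 𝔥ₙ`; in the tree: absolute
convergence, `ϑ(z + p) = ϑ(z)`, `ϑ(z + Ωq) = exp(-πi ᵗqΩq - 2πi ᵗqz) ϑ(z)`, holomorphy). The sections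
of the cube `L³` of the principal theta bundle used by Lefschetz's trick are the products
`s_{a,b}(z) = ϑ(z + a) ϑ(z + b) ϑ(z - a - b)` (same factor of automorphy for all `a, b` — the analytic
theorem of the square). -/

/-- **stub_thetaNonvanishing** [M]. The Riemann theta function of `Ω ∈ 𝔥ₙ` is not identically zero
(its Fourier coefficient at `m = 0` is `∫_{[0,1]ⁿ} ϑ(x + iy) dx = 1`; Mumford, Tata I, Ch. II §1,
Prop. 1.3 ff.; Lange–Birkenhake §3.2). -/
theorem stub_thetaNonvanishing :
    ∀ ⦃n : ℕ⦄ (Ω : Matrix (Fin n) (Fin n) ℂ), (∀ i j, Ω i j = Ω j i) → (Ω.map Complex.im).PosDef →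
      ∃ z : Fin n → ℂ, riemannTheta Ω z ≠ 0 :=
  Literature.Analysis.SpecialFunctions.riemannTheta_not_identically_zero

/-- **stub_thetaSeparatesPoints** [L]. Lefschetz's injectivity step for the principal theta functions
(Mumford, Abelian Varieties §17, proof of Lefschetz's theorem; Lange–Birkenhake Thm. 4.5.1, Step II;
Griffiths–Harris Ch. 2 §6): if the values of ALL the products `s_{a,b} = ϑ(· + a)ϑ(· + b)ϑ(· - a - b)`
at `z₂` are a common multiple `c` of their values at `z₁`, then `z₂ ≡ z₁ (mod ℤⁿ ⊕ Ωℤⁿ)`. Paper proof: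
with `u = z₂ - z₁`, `x = z₁ + a`, `y = z₁ + b`, `k = 3z₁` the hypothesis reads
`ϑ(x+u)ϑ(y+u)ϑ(k-x-y+u) = c ϑ(x)ϑ(y)ϑ(k-x-y)` for all `x, y`; `c ≠ 0` (else `ϑ ≡ 0`); near a point
where nothing vanishes, `H = ϑ(·+u)/ϑ` satisfies `H(x)H(y)H(k-x-y) = c`, so `∂ log H(x) = ∂ log H(y)`,
`∂ log H` is constant, `ϑ(x + u) = C e^{ᵗw x} ϑ(x)` locally hence globally (identity theorem);
comparing the `ℤⁿ`- and `Ωℤⁿ`-quasi-periods of both sides gives `w ∈ 2πiℤⁿ`, `w = 2πi m`, and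
`u + Ωm ∈ ℤⁿ`. -/
theorem stub_thetaSeparatesPoints :
    ∀ ⦃n : ℕ⦄ (Ω : Matrix (Fin n) (Fin n) ℂ), (∀ i j, Ω i j = Ω j i) → (Ω.map Complex.im).PosDef →
      (∃ z : Fin n → ℂ, riemannTheta Ω z ≠ 0) →
      ∀ (z₁ z₂ : Fin n → ℂ) (c : ℂ),
      (∀ a b : Fin n → ℂ,
        riemannTheta Ω (z₂ + a) * riemannTheta Ω (z₂ + b) * riemannTheta Ω (z₂ - a - b) =
          c * (riemannTheta Ω (z₁ + a) * riemannTheta Ω (z₁ + b) * riemannTheta Ω (z₁ - a - b))) →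
      ∃ p q : Fin n → ℤ, z₂ - z₁ = fun i => (p i : ℂ) + ∑ j, Ω i j * (q j : ℂ) :=
  Literature.Analysis.SpecialFunctions.riemannTheta_cubic_separatesPoints

/-- **stub_thetaSeparatesTangents** [L]. Lefschetz's immersivity step (same sources, Step III): if for
a tangent vector `t` the derivatives `∂_t s_{a,b}(z)` of ALL the products are a common multiple `c` of
the values `s_{a,b}(z)`, then `t = 0`. Paper proof: with `g = ∂_tϑ - (c/3)ϑ` the hypothesis reads
`g(x)ϑ(y)ϑ(w) + ϑ(x)g(y)ϑ(w) + ϑ(x)ϑ(y)g(w) = 0` (`w = 3z - x - y`); where `ϑ ≠ 0`, `h = g/ϑ` has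
`h(x) + h(y) + h(3z-x-y) = 0`, so `∇h(x) = ∇h(y)`, `h` is affine, `∂_tϑ = (ᵗαx + γ)ϑ` globally;
`ℤⁿ`-periodicity forces `α = 0`, and differentiating the `Ωq`-quasi-periodicity along `t` gives
`ᵗq t = 0` for all `q ∈ ℤⁿ`. -/
theorem stub_thetaSeparatesTangents :
    ∀ ⦃n : ℕ⦄ (Ω : Matrix (Fin n) (Fin n) ℂ), (∀ i j, Ω i j = Ω j i) → (Ω.map Complex.im).PosDef →
      (∃ z : Fin n → ℂ, riemannTheta Ω z ≠ 0) →
      ∀ (z t : Fin n → ℂ) (c : ℂ),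
      (∀ a b : Fin n → ℂ,
        fderiv ℂ (fun w => riemannTheta Ω (w + a) * riemannTheta Ω (w + b) * riemannTheta Ω (w - a - b))
            z t =
          c * (riemannTheta Ω (z + a) * riemannTheta Ω (z + b) * riemannTheta Ω (z - a - b))) →
      t = 0 :=
  Literature.Analysis.SpecialFunctions.riemannTheta_cubic_separatesTangents

/-- **stub_thetaAssembly** [L; the lead's]. From the three analytic facts to Lefschetz's embedding:
the products `s_{a,b}` are holomorphic with the common factor of automorphy
`exp(-3πi ᵗqΩq - 6πi ᵗqz)` under `z ↦ z + p + Ωq`, so every finite family of them defines a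
holomorphic map `ComplexTorus Φ → ℙᴺ(ℂ)` off its common zeros; by compactness of the torus and of the
set of pairs of points off a neighbourhood of the diagonal, finitely many products have no common
zero, separate points (stub `…SeparatesPoints`) and tangent vectors (stub `…SeparatesTangents`), giving
an injective holomorphic immersion. Lange–Birkenhake Thm. 4.5.1; Mumford AV §17; Griffiths–Harris
Ch. 1 §4 (compactness argument for embeddings by sections). -/
theorem stub_thetaAssembly :
    (∀ ⦃n : ℕ⦄ (Ω : Matrix (Fin n) (Fin n) ℂ), (∀ i j, Ω i j = Ω j i) → (Ω.map Complex.im).PosDef →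
      ∃ z : Fin n → ℂ, riemannTheta Ω z ≠ 0) →
    (∀ ⦃n : ℕ⦄ (Ω : Matrix (Fin n) (Fin n) ℂ), (∀ i j, Ω i j = Ω j i) → (Ω.map Complex.im).PosDef →
      (∃ z : Fin n → ℂ, riemannTheta Ω z ≠ 0) →
      ∀ (z₁ z₂ : Fin n → ℂ) (c : ℂ),
      (∀ a b : Fin n → ℂ,
        riemannTheta Ω (z₂ + a) * riemannTheta Ω (z₂ + b) * riemannTheta Ω (z₂ - a - b) =
          c * (riemannTheta Ω (z₁ + a) * riemannTheta Ω (z₁ + b) * riemannTheta Ω (z₁ - a - b))) →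
      ∃ p q : Fin n → ℤ, z₂ - z₁ = fun i => (p i : ℂ) + ∑ j, Ω i j * (q j : ℂ)) →
    (∀ ⦃n : ℕ⦄ (Ω : Matrix (Fin n) (Fin n) ℂ), (∀ i j, Ω i j = Ω j i) → (Ω.map Complex.im).PosDef →
      (∃ z : Fin n → ℂ, riemannTheta Ω z ≠ 0) →
      ∀ (z t : Fin n → ℂ) (c : ℂ),
      (∀ a b : Fin n → ℂ,
        fderiv ℂ (fun w => riemannTheta Ω (w + a) * riemannTheta Ω (w + b) * riemannTheta Ω (w - a - b))
            z t =
          c * (riemannTheta Ω (z + a) * riemannTheta Ω (z + b) * riemannTheta Ω (z - a - b))) →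
      t = 0) →
    ∀ ⦃n : ℕ⦄ (Ω : Matrix (Fin n) (Fin n) ℂ), (∀ i j, Ω i j = Ω j i) →
      (Matrix.of fun i j => (Ω i j).im).PosDef →
      ∀ (Φ : (Fin n ⊕ Fin n → ℝ) ≃L[ℝ] (Fin n → ℂ)),
      (∀ v i, Φ v i = (v (Sum.inl i) : ℂ) + ∑ j, Ω i j * (v (Sum.inr j) : ℂ)) →
      ∃ (N : ℕ) (F : ComplexTorus Φ → ℙ ℂ (Fin (N + 1) → ℂ)),
        ContMDiff 𝓘(ℂ, Fin n → ℂ) 𝓘(ℂ, Fin N → ℂ) ω F ∧ Function.Injective F ∧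
        ∀ x, Function.Injective (mfderiv 𝓘(ℂ, Fin n → ℂ) 𝓘(ℂ, Fin N → ℂ) F x) :=
  fun _ _ _ _ Ω hΩ hpos Φ hΦ => Literature.Geometry.Kaehler.siegelTorus_thetaEmbedding Ω hΩ hpos Φ hΦ

/-- **The theta embedding (Lefschetz's theorem for principally polarised tori in Siegel normal form)**,
from the four theta stubs: for `Ω ∈ 𝔥ₙ` and the period isomorphism `Φ : ℝⁿ ⊕ ℝⁿ ≃ ℂⁿ`,
`(x, y) ↦ x + Ωy` (`ComplexTorus Φ = ℂⁿ/(ℤⁿ ⊕ Ωℤⁿ)`), there are `N` and an injective holomorphic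
immersion `F : ComplexTorus Φ → ℙᴺ(ℂ)`. Mumford, Tata Lectures on Theta I, Ch. II §1; Lange–Birkenhake
1992 Thm. 4.5.1; Mumford AV §17. [cite: LangeBirkenhake1992, Thm. 4.5.1] -/
theorem stub_thetaEmbedding :
    ∀ ⦃n : ℕ⦄ (Ω : Matrix (Fin n) (Fin n) ℂ), (∀ i j, Ω i j = Ω j i) →
      (Matrix.of fun i j => (Ω i j).im).PosDef →
      ∀ (Φ : (Fin n ⊕ Fin n → ℝ) ≃L[ℝ] (Fin n → ℂ)),
      (∀ v i, Φ v i = (v (Sum.inl i) : ℂ) + ∑ j, Ω i j * (v (Sum.inr j) : ℂ)) →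
      ∃ (N : ℕ) (F : ComplexTorus Φ → ℙ ℂ (Fin (N + 1) → ℂ)),
        ContMDiff 𝓘(ℂ, Fin n → ℂ) 𝓘(ℂ, Fin N → ℂ) ω F ∧ Function.Injective F ∧
        ∀ x, Function.Injective (mfderiv 𝓘(ℂ, Fin n → ℂ) 𝓘(ℂ, Fin N → ℂ) F x) :=
  stub_thetaAssembly stub_thetaNonvanishing stub_thetaSeparatesPoints stub_thetaSeparatesTangents

/-- **stub_imageAnalytic** [M]. The image of a compact complex manifold `M` (model `ℂⁿ`) under an
injective holomorphic immersion `F : M → ℙᴺ(ℂ)` is an analytic subset of `ℙᴺ(ℂ)`: at a point `F x`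
the rank theorem straightens the immersion, `F` is a closed embedding (compact → Hausdorff), so
`range F` is locally the zero set of the last `N - n` straightened coordinates; off the (closed) image
it is locally empty. Chirka, Complex Analytic Sets §2.1–2.3; Griffiths–Harris Ch. 0 §2;
Fritzsche–Grauert Ch. IV. Instances on `ℙᴺ(ℂ)`: `isManifold_projectivization_holds`,
`t2Space_projectivization_holds`. -/
theorem stub_imageAnalytic :
    ∀ ⦃n N : ℕ⦄ ⦃M : Type⦄ [TopologicalSpace M] [T2Space M] [CompactSpace M]
      [ChartedSpace (Fin n → ℂ) M] [IsManifold 𝓘(ℂ, Fin n → ℂ) ω M]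
      (F : M → ℙ ℂ (Fin (N + 1) → ℂ)),
      ContMDiff 𝓘(ℂ, Fin n → ℂ) 𝓘(ℂ, Fin N → ℂ) ω F → Function.Injective F →
      (∀ x, Function.Injective (mfderiv 𝓘(ℂ, Fin n → ℂ) 𝓘(ℂ, Fin N → ℂ) F x)) →
      IsAnalyticSet 𝓘(ℂ, Fin N → ℂ) (Set.range F) :=
  _root_.Summit.HodgeConjecture.HodgeConjecture.Theorems.RiemannWeightOne.stub_imageAnalytic

/-- **stub_algebraisation** [L]. Let `F : M → ℙᴺ(ℂ)` be injective and holomorphic on a compact complex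
manifold `M` (model `ℂⁿ`) whose image is a projective algebraic set (`IsProjAlgebraicSet`, e.g. by
Chow). Then there are a REDUCED closed subscheme `ι : X ↪ ℙᴺ_ℂ` whose complex points are exactly the
image (`X` = the reduced induced structure on the Zariski-closed set `V₊(S)`, Mathlib
`Scheme.IdealSheafData.vanishingIdeal … .subscheme`) and a map `φ : M → X(ℂ)` over `F`
(`ι(ℂ) ∘ φ = projPoint ∘ F`) which IS an analytification of `X`: a homeomorphism (all maps are
closed embeddings of compacta) along which regular functions on affine opens pull back to holomorphic
functions (a closed immersion is surjective on stalks, so a regular germ on `X` is the restriction of a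
regular germ on `ℙᴺ`, holomorphic along `projPoint` by `isAnalytification_projPoint`, then compose
with `F`). Serre, GAGA §2 n°5 (Lemme 1, Prop. 2) p. 9; Hartshorne II Ex. 3.11 (d), Example 3.2.6.
Tree: `exists_eval_eq_of_stalkMap_surjective` (`AnalytificationImmersivePoint`), `projPoint_*`,
`preimage_projPoint_setOf_pt_mem_basicOpen`, `Motives.liftOfRangeSubset`. -/
theorem stub_algebraisation :
    ∀ ⦃n N : ℕ⦄ ⦃M : Type⦄ [TopologicalSpace M] [T2Space M] [CompactSpace M]
      [ChartedSpace (Fin n → ℂ) M] [IsManifold 𝓘(ℂ, Fin n → ℂ) ω M]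
      (F : M → ℙ ℂ (Fin (N + 1) → ℂ)),
      ContMDiff 𝓘(ℂ, Fin n → ℂ) 𝓘(ℂ, Fin N → ℂ) ω F → Function.Injective F →
      IsProjAlgebraicSet (Set.range F) →
      ∃ (X : SchemeOver ℂ) (ι : X ⟶ projectiveSpace N ℂ) (_ : IsClosedImmersion ι.left)
        (_ : IsReduced X.left) (φ : M → ComplexPoints X),
        IsAnalytification (Fin n → ℂ) X n φ ∧ ∀ m, AlgPoints.map ι (φ m) = projPoint N (F m) :=
  _root_.Summit.HodgeConjecture.HodgeConjecture.Theorems.RiemannWeightOne.stub_algebraisation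

/-- **stub_algebraisationSmooth** [L–XL]. In the situation of `stub_algebraisation`, if moreover `M` is
connected and `F` is an immersion, the reduced closed subscheme `X ⊆ ℙᴺ_ℂ` with `X(ℂ) = F(M)` is
smooth projective of dimension `n` (`IsSmoothProjective n X`: projective — `ι`; geometrically
irreducible — `X` is reduced and `X(ℂ) ≅ M` is a connected manifold, a union of two proper
Zariski-closed subsets would be a union of two nowhere dense analytic subsets; smooth of relative
dimension `n` — at every complex point the analytic germ of `X(ℂ) ⊆ ℙᴺ(ℂ)` is a submanifold germ of
dimension `n`, and for the REDUCED structure this forces the algebraic local ring to be regular of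
dimension `n`: Serre GAGA §2 n°6 Prop. 3 with its corollaries and the reducedness of `X^h`; closed
points suffice for smoothness over `ℂ`). Serre, GAGA (1956) §2 n°6–8; Chow 1949 Thm. V;
Griffiths–Harris Ch. 1 §3 ("Chow's theorem" and the comparison of tangent spaces). Tree:
`GAGADimension*` (dimension comparison), `ZariskiClosedStraightening` (simple points),
`GAGALocalEquation.exists_forall_isRegularLocalRing` (generic smoothness). -/
theorem stub_algebraisationSmooth :
    ∀ ⦃n N : ℕ⦄ ⦃M : Type⦄ [TopologicalSpace M] [T2Space M] [CompactSpace M] [ConnectedSpace M]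
      [ChartedSpace (Fin n → ℂ) M] [IsManifold 𝓘(ℂ, Fin n → ℂ) ω M]
      (F : M → ℙ ℂ (Fin (N + 1) → ℂ)),
      ContMDiff 𝓘(ℂ, Fin n → ℂ) 𝓘(ℂ, Fin N → ℂ) ω F → Function.Injective F →
      (∀ x, Function.Injective (mfderiv 𝓘(ℂ, Fin n → ℂ) 𝓘(ℂ, Fin N → ℂ) F x)) →
      ∀ ⦃X : SchemeOver ℂ⦄ (ι : X ⟶ projectiveSpace N ℂ) [IsClosedImmersion ι.left]
        [IsReduced X.left] (φ : M → ComplexPoints X),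
        IsAnalytification (Fin n → ℂ) X n φ → (∀ m, AlgPoints.map ι (φ m) = projPoint N (F m)) →
        IsSmoothProjective n X :=
  _root_.Summit.HodgeConjecture.HodgeConjecture.Theorems.RiemannWeightOne.stub_algebraisationSmooth

/-- **stub_transfer** [M]. Invariance of `IsAnalytification` under a change of period isomorphism with
`ℂ`-linear transition: `ComplexTorus Φ` and `ComplexTorus Φ'` are the same topological space
`(ℝ/ℤ)^ι`, and when `Φ ∘ Φ'⁻¹` is `ℂ`-linear the identity `ComplexTorus Φ' → ComplexTorus Φ` is
holomorphic (its lift to the universal covers is `Φ ∘ Φ'⁻¹`; tree: `ComplexTorus.contMDiff_of_lift` /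
`contMDiff_mapMatrix` with `A = 1`), so the pull-back of a regular function, holomorphic on
`ComplexTorus Φ`, is holomorphic on `ComplexTorus Φ'`. Lange–Birkenhake 1992 §1.1.2. -/
theorem stub_transfer :
    ∀ ⦃ι : Type⦄ [Fintype ι] ⦃n : ℕ⦄ (Φ Φ' : (ι → ℝ) ≃L[ℝ] (Fin n → ℂ)),
      (∀ u, Φ (Φ'.symm (Complex.I • u)) = Complex.I • Φ (Φ'.symm u)) →
      ∀ ⦃X : SchemeOver ℂ⦄ (φ : ComplexTorus Φ → ComplexPoints X),
        IsAnalytification (Fin n → ℂ) X n φ →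
        IsAnalytification (Fin n → ℂ) X n (fun t : ComplexTorus Φ' => φ t) :=
  _root_.Summit.HodgeConjecture.HodgeConjecture.Theorems.RiemannWeightOne.stub_transfer

/-- **stub_torusCohomologyBasis** [M]. The Literature theorem
`HodgeTheory.weightOne_torusCohomology_of_isAnalytification` (the weight-one Hodge structure of the
algebraised torus `(V_ℝ, J)/⊕ ℤ(1 ⊗ bᵢ)` maps ONTO `hodgeStructureOfCx J hJ`) for an ARBITRARY
`ℚ`-basis `b` of `V` in place of `Module.finBasis ℚ V` — same proof (`φ_E : V ≅ ℚ^κ`,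
`x ↦ (E(x, bₐ))ₐ`; `exists_hodgeModel_weightOne_of_complexTorus`; `exists_mkCx_eq_sum_tmul` with `b`).
Voisin I §7.2.2 (PDF p. 142); Lange–Birkenhake Lemma 1.1.17, Thm. 1.1.21, §2.4. -/
theorem stub_torusCohomologyBasis :
    ∀ ⦃V : Type⦄ [AddCommGroup V] [Module ℚ V] [Module.Finite ℚ V] ⦃κ : Type⦄ [Fintype κ]
      (b : Module.Basis κ ℚ V)
      (J : ℝ ⊗[ℚ] V →ₗ[ℝ] ℝ ⊗[ℚ] V) (hJ : ∀ a, J (J a) = -a) (hJ' : J * J = -1)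
      (E : LinearMap.BilinForm ℚ V),
      (∀ x y, E y x = -E x y) → (∀ a c, E.baseChange ℝ (J a) (J c) = E.baseChange ℝ a c) →
      (∀ a, a ≠ 0 → 0 < E.baseChange ℝ a (J a)) →
      ∀ ⦃n : ℕ⦄ (hn : Module.finrank ℝ (ℝ ⊗[ℚ] V) = 2 * n) (X : SchemeOver ℂ)
        (hX : IsSmoothProjective n X)
        (φ : ComplexTorus (CxModule.periodIso J hJ' hn (b.baseChange ℝ)) → ComplexPoints X),
        IsAnalytification (Fin n → ℂ) X n φ →
        ∃ (B : HodgeModel n X) (hB : B.IsHodgeSymmetric)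
          (f : HodgeStructure.Hom ((B.hodgeStructure hX hB 1).cast Nat.cast_one)
            (HodgeStructure.hodgeStructureOfCx J hJ)),
          Function.Surjective f.toLinearMap :=
  _root_.Summit.HodgeConjecture.HodgeConjecture.Theorems.RiemannWeightOne.stub_torusCohomologyBasis

/-! ## Glue (proved) -/

/-- A rational Riemann form is alternating (`E(x, x) = 0`, characteristic `0`). [folklore] -/
theorem isAlt_of_skew {V : Type} [AddCommGroup V] [Module ℚ V] (E : LinearMap.BilinForm ℚ V)
    (hE : ∀ x y, E y x = -E x y) : E.IsAlt := by
  intro x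
  have h := hE x x
  linarith

/-- A rational form with the Riemann positivity `E_ℝ(a, Ja) > 0` is non-degenerate over `ℚ`:
if `E(x, ·) = 0` then `E_ℝ(1 ⊗ x, ·) = 0`, so `1 ⊗ x = 0`, so `x = 0`; right non-degeneracy by
skew-symmetry. [cite: LangeBirkenhake1992, §2.1 Lemma 2.1.7] -/
theorem nondegenerate_of_riemannForm {V : Type} [AddCommGroup V] [Module ℚ V] [Module.Finite ℚ V]
    (J : ℝ ⊗[ℚ] V →ₗ[ℝ] ℝ ⊗[ℚ] V) (E : LinearMap.BilinForm ℚ V) (hE : ∀ x y, E y x = -E x y)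
    (hpos : ∀ a, a ≠ 0 → 0 < E.baseChange ℝ a (J a)) : E.Nondegenerate := by
  classical
  have hleft : ∀ x : V, (∀ y, E x y = 0) → x = 0 := by
    intro x hx
    let ψ : V →ₗ[ℚ] (Fin (Module.finrank ℚ V) → ℚ) :=
      LinearMap.pi fun a => E.flip (Module.finBasis ℚ V a)
    have hψ : ∀ x a, ψ x a = E x (Module.finBasis ℚ V a) := fun x a => rfl
    have hinj := Literature.AlgebraicGeometry.HodgeTheory.injective_of_riemannForm J E ψ hpos hψ
    apply hinj
    ext a
    rw [hψ, hx, map_zero, Pi.zero_apply]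
  refine ⟨fun x hx => hleft x hx, fun y hy => hleft y fun x => ?_⟩
  rw [hE x y, hy x, neg_zero]

/-- **The composition, implication form** `stub₁ → … → stub₇ → (Riemann, geometric form)` — no
`sorry`. Proof (the printed one, Voisin I §7.2.2 / Lange–Birkenhake §4.1, §8.1, Thm. 4.5.1, App. A):
complex structure `J`, rational Riemann form `E` and `hodgeStructureOfCx J hJ ↠ H`
(`exists_cx_riemannForm_hom_of_isPolarizable`); a symplectic `ℚ`-basis `b` of `(V, E)`
(`exists_symplecticBasis`) — the lattice `Λ = ⊕ ℤ(1 ⊗ bᵢ)` makes the polarisation principal; Siegel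
normal form `Ψ : (V_ℝ, J) ≅ ℂⁿ`, `Λ ↦ ℤⁿ ⊕ Ωℤⁿ` (stub 1); theta embedding `F` of
`T = ComplexTorus Φ_Ω` into `ℙᴺ(ℂ)` (stub 2); `F(T)` is analytic (stub 3), hence projective algebraic
(Chow, `isProjAlgebraicSet_of_isAnalyticSet_holds`); the reduced subscheme `X` on it is analytified by
`T` (stub 4) and smooth projective of dimension `n` (stub 5); move the analytification to the
presentation `periodIso J (b ⊗ ℝ)` of the same torus (stub 6, the transition `coordJ ∘ Ψ⁻¹` is
`ℂ`-linear); read `H¹` (stub 7); compose with `e`. [cite: VoisinHodgeI2002, §7.2.2]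
[cite: LangeBirkenhake1992, Thm. 4.5.1 and §8.1] [cite: SerreGAGA1956, §2–§3] -/
theorem riemannWeightOne_of_stubs
    (h₁ : ∀ ⦃V : Type⦄ [AddCommGroup V] [Module ℚ V] [Module.Finite ℚ V]
      (J : ℝ ⊗[ℚ] V →ₗ[ℝ] ℝ ⊗[ℚ] V) (_hJ : ∀ a, J (J a) = -a) (E : LinearMap.BilinForm ℚ V),
      (∀ x y, E y x = -E x y) → (∀ a c, E.baseChange ℝ (J a) (J c) = E.baseChange ℝ a c) →
      (∀ a, a ≠ 0 → 0 < E.baseChange ℝ a (J a)) →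
      ∀ ⦃n : ℕ⦄ (b : Module.Basis (Fin n ⊕ Fin n) ℚ V),
      (∀ i j, E (b (Sum.inl i)) (b (Sum.inl j)) = 0) →
      (∀ i j, E (b (Sum.inr i)) (b (Sum.inr j)) = 0) →
      (∀ i j, E (b (Sum.inl i)) (b (Sum.inr j)) = if i = j then 1 else 0) →
      ∃ (Ψ : ℝ ⊗[ℚ] V ≃ₗ[ℝ] (Fin n → ℂ)) (Ω : Matrix (Fin n) (Fin n) ℂ),
        (∀ a, Ψ (J a) = Complex.I • Ψ a) ∧
        (∀ i j, Ω i j = Ω j i) ∧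
        (Matrix.of fun i j => (Ω i j).im).PosDef ∧
        (∀ i, Ψ ((1 : ℝ) ⊗ₜ[ℚ] b (Sum.inl i)) = Pi.single i 1) ∧
        (∀ j, Ψ ((1 : ℝ) ⊗ₜ[ℚ] b (Sum.inr j)) = fun i => Ω i j))
    (h₂ : ∀ ⦃n : ℕ⦄ (Ω : Matrix (Fin n) (Fin n) ℂ), (∀ i j, Ω i j = Ω j i) →
      (Matrix.of fun i j => (Ω i j).im).PosDef →
      ∀ (Φ : (Fin n ⊕ Fin n → ℝ) ≃L[ℝ] (Fin n → ℂ)),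
      (∀ v i, Φ v i = (v (Sum.inl i) : ℂ) + ∑ j, Ω i j * (v (Sum.inr j) : ℂ)) →
      ∃ (N : ℕ) (F : ComplexTorus Φ → ℙ ℂ (Fin (N + 1) → ℂ)),
        ContMDiff 𝓘(ℂ, Fin n → ℂ) 𝓘(ℂ, Fin N → ℂ) ω F ∧ Function.Injective F ∧
        ∀ x, Function.Injective (mfderiv 𝓘(ℂ, Fin n → ℂ) 𝓘(ℂ, Fin N → ℂ) F x))
    (h₃ : ∀ ⦃n N : ℕ⦄ ⦃M : Type⦄ [TopologicalSpace M] [T2Space M] [CompactSpace M]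
      [ChartedSpace (Fin n → ℂ) M] [IsManifold 𝓘(ℂ, Fin n → ℂ) ω M]
      (F : M → ℙ ℂ (Fin (N + 1) → ℂ)),
      ContMDiff 𝓘(ℂ, Fin n → ℂ) 𝓘(ℂ, Fin N → ℂ) ω F → Function.Injective F →
      (∀ x, Function.Injective (mfderiv 𝓘(ℂ, Fin n → ℂ) 𝓘(ℂ, Fin N → ℂ) F x)) →
      IsAnalyticSet 𝓘(ℂ, Fin N → ℂ) (Set.range F))
    (h₄ : ∀ ⦃n N : ℕ⦄ ⦃M : Type⦄ [TopologicalSpace M] [T2Space M] [CompactSpace M]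
      [ChartedSpace (Fin n → ℂ) M] [IsManifold 𝓘(ℂ, Fin n → ℂ) ω M]
      (F : M → ℙ ℂ (Fin (N + 1) → ℂ)),
      ContMDiff 𝓘(ℂ, Fin n → ℂ) 𝓘(ℂ, Fin N → ℂ) ω F → Function.Injective F →
      IsProjAlgebraicSet (Set.range F) →
      ∃ (X : SchemeOver ℂ) (ι : X ⟶ projectiveSpace N ℂ) (_ : IsClosedImmersion ι.left)
        (_ : IsReduced X.left) (φ : M → ComplexPoints X),
        IsAnalytification (Fin n → ℂ) X n φ ∧ ∀ m, AlgPoints.map ι (φ m) = projPoint N (F m))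
    (h₅ : ∀ ⦃n N : ℕ⦄ ⦃M : Type⦄ [TopologicalSpace M] [T2Space M] [CompactSpace M] [ConnectedSpace M]
      [ChartedSpace (Fin n → ℂ) M] [IsManifold 𝓘(ℂ, Fin n → ℂ) ω M]
      (F : M → ℙ ℂ (Fin (N + 1) → ℂ)),
      ContMDiff 𝓘(ℂ, Fin n → ℂ) 𝓘(ℂ, Fin N → ℂ) ω F → Function.Injective F →
      (∀ x, Function.Injective (mfderiv 𝓘(ℂ, Fin n → ℂ) 𝓘(ℂ, Fin N → ℂ) F x)) →
      ∀ ⦃X : SchemeOver ℂ⦄ (ι : X ⟶ projectiveSpace N ℂ) [IsClosedImmersion ι.left]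
        [IsReduced X.left] (φ : M → ComplexPoints X),
        IsAnalytification (Fin n → ℂ) X n φ → (∀ m, AlgPoints.map ι (φ m) = projPoint N (F m)) →
        IsSmoothProjective n X)
    (h₆ : ∀ ⦃ι : Type⦄ [Fintype ι] ⦃n : ℕ⦄ (Φ Φ' : (ι → ℝ) ≃L[ℝ] (Fin n → ℂ)),
      (∀ u, Φ (Φ'.symm (Complex.I • u)) = Complex.I • Φ (Φ'.symm u)) →
      ∀ ⦃X : SchemeOver ℂ⦄ (φ : ComplexTorus Φ → ComplexPoints X),
        IsAnalytification (Fin n → ℂ) X n φ →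
        IsAnalytification (Fin n → ℂ) X n (fun t : ComplexTorus Φ' => φ t))
    (h₇ : ∀ ⦃V : Type⦄ [AddCommGroup V] [Module ℚ V] [Module.Finite ℚ V] ⦃κ : Type⦄ [Fintype κ]
      (b : Module.Basis κ ℚ V)
      (J : ℝ ⊗[ℚ] V →ₗ[ℝ] ℝ ⊗[ℚ] V) (hJ : ∀ a, J (J a) = -a) (hJ' : J * J = -1)
      (E : LinearMap.BilinForm ℚ V),
      (∀ x y, E y x = -E x y) → (∀ a c, E.baseChange ℝ (J a) (J c) = E.baseChange ℝ a c) →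
      (∀ a, a ≠ 0 → 0 < E.baseChange ℝ a (J a)) →
      ∀ ⦃n : ℕ⦄ (hn : Module.finrank ℝ (ℝ ⊗[ℚ] V) = 2 * n) (X : SchemeOver ℂ)
        (hX : IsSmoothProjective n X)
        (φ : ComplexTorus (CxModule.periodIso J hJ' hn (b.baseChange ℝ)) → ComplexPoints X),
        IsAnalytification (Fin n → ℂ) X n φ →
        ∃ (B : HodgeModel n X) (hB : B.IsHodgeSymmetric)
          (f : HodgeStructure.Hom ((B.hodgeStructure hX hB 1).cast Nat.cast_one)
            (HodgeStructure.hodgeStructureOfCx J hJ)),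
          Function.Surjective f.toLinearMap) :
    Literature.AlgebraicGeometry.HodgeTheory.weightOne_polarizable_eq_range_of_smoothProjective := by
  intro V _ _ _ H hpol heff
  classical
  -- S1: complex structure `J`, Riemann form `E`, and `hodgeStructureOfCx J hJ ↠ H`
  obtain ⟨J, hJ, E, hE, hEJ, hpos, -, e, he⟩ :=
    Literature.AlgebraicGeometry.HodgeTheory.exists_cx_riemannForm_hom_of_isPolarizable H hpol heff
  have hJ' : J * J = -1 := LinearMap.ext fun a => by simp [Module.End.mul_apply, hJ a]
  -- a symplectic `ℚ`-basis of `(V, E)`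
  obtain ⟨n, b, hb₁, hb₂, hb₁₂⟩ := Literature.Geometry.Symplectic.exists_symplecticBasis E
    (isAlt_of_skew E hE) (nondegenerate_of_riemannForm J E hE hpos)
  have hVn : Module.finrank ℚ V = 2 * n := by
    rw [Module.finrank_eq_card_basis b, Fintype.card_sum, Fintype.card_fin]
    ring
  have hn : Module.finrank ℝ (ℝ ⊗[ℚ] V) = 2 * n := by rw [Module.finrank_baseChange, hVn]
  -- Siegel normal form
  obtain ⟨Ψ, Ω, hΨJ, hΩs, hΩp, hΨ₁, hΨ₂⟩ := h₁ J hJ E hE hEJ hpos b hb₁ hb₂ hb₁₂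
  -- the Siegel period isomorphism `Φ_Ω : ℝⁿ ⊕ ℝⁿ ≃ ℂⁿ`, `(x, y) ↦ x + Ω y`
  set bR : Module.Basis (Fin n ⊕ Fin n) ℝ (ℝ ⊗[ℚ] V) := b.baseChange ℝ with hbR
  let ΦΩ : (Fin n ⊕ Fin n → ℝ) ≃L[ℝ] (Fin n → ℂ) :=
    (bR.equivFun.symm.trans Ψ).toContinuousLinearEquiv
  have hΦΩ_apply : ∀ v, ΦΩ v = Ψ (bR.equivFun.symm v) := fun v => rfl
  have hΦΩ : ∀ v i, ΦΩ v i = (v (Sum.inl i) : ℂ) + ∑ j, Ω i j * (v (Sum.inr j) : ℂ) := by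
    intro v i
    rw [hΦΩ_apply, Module.Basis.equivFun_symm_apply, map_sum, Finset.sum_apply,
      Fintype.sum_sum_type]
    simp only [map_smul, Pi.smul_apply, hbR, Module.Basis.baseChange_apply, hΨ₁, hΨ₂,
      Complex.real_smul]
    congr 1
    · rw [Finset.sum_eq_single i]
      · simp
      · intro j _ hj
        simp [Ne.symm hj]
      · simp
    · exact Finset.sum_congr rfl fun j _ => by ring
  -- Lefschetz: theta embedding of `T = ComplexTorus Φ_Ω`
  obtain ⟨N, F, hF, hFinj, hFimm⟩ := h₂ Ω hΩs hΩp ΦΩ hΦΩ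
  haveI : IsManifold 𝓘(ℂ, Fin N → ℂ) ω (ℙ ℂ (Fin (N + 1) → ℂ)) :=
    Literature.NumberTheory.Transcendental.isManifold_projectivization_holds ℂ N
  haveI : T2Space (ℙ ℂ (Fin (N + 1) → ℂ)) :=
    Literature.NumberTheory.Transcendental.t2Space_projectivization_holds ℂ N
  -- the image is a closed analytic subset, hence projective algebraic (Chow)
  have hAn : IsAnalyticSet 𝓘(ℂ, Fin N → ℂ) (Set.range F) := h₃ F hF hFinj hFimm
  have hcl : IsClosed (Set.range F) := (isCompact_range hF.continuous).isClosed
  have hAlg : IsProjAlgebraicSet (Set.range F) :=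
    isProjAlgebraicSet_of_isAnalyticSet_holds (n := N) hcl hAn
  -- algebraise: reduced closed subscheme `X ⊆ ℙᴺ`, analytified by the torus, smooth projective
  obtain ⟨X, ιX, hιX, hXred, φ₀, hφ₀, hcomp⟩ := h₄ F hF hFinj hAlg
  haveI := hιX
  haveI := hXred
  have hX : IsSmoothProjective n X := h₅ F hF hFinj hFimm ιX φ₀ hφ₀ hcomp
  -- transfer to the presentation `periodIso J (b ⊗ ℝ)` of the same torus
  set Φ₁ : (Fin n ⊕ Fin n → ℝ) ≃L[ℝ] (Fin n → ℂ) := CxModule.periodIso J hJ' hn bR with hΦ₁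
  have htrans : ∀ u, ΦΩ (Φ₁.symm (Complex.I • u)) = Complex.I • ΦΩ (Φ₁.symm u) := by
    intro u
    rw [hΦΩ_apply, hΦΩ_apply, hΦ₁, CxModule.periodIso_symm_apply, CxModule.periodIso_symm_apply,
      LinearEquiv.symm_apply_apply, LinearEquiv.symm_apply_apply, CxModule.coordJ_symm_I_smul, hΨJ]
  have hφ₁ : IsAnalytification (Fin n → ℂ) X n (fun t : ComplexTorus Φ₁ => φ₀ t) :=
    h₆ ΦΩ Φ₁ htrans φ₀ hφ₀
  -- read `H¹` and compose with `e`
  obtain ⟨B, hB, f, hf⟩ := h₇ b J hJ hJ' E hE hEJ hpos hn X hX (fun t => φ₀ t) hφ₁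
  exact ⟨n, X, hX, B, hB, e.comp f, he.comp hf⟩

/-- **THE SKELETON COMPOSITION** — concludes the crux BY NAME (type literally the route decl),
hypothesis-free, from the seven registered stubs by name; no `sorry` of its own.
[cite: VoisinHodgeI2002, §7.2.2] [cite: LangeBirkenhake1992, Thm. 4.5.1 and §8.1] -/
theorem RiemannWeightOne_of :
    Summit.HodgeConjecture.HodgeConjecture.Theses.SecondaryPeriods.RiemannWeightOne :=
  riemannWeightOne_of_stubs stub_siegelForm stub_thetaEmbedding stub_imageAnalytic
    stub_algebraisation stub_algebraisationSmooth stub_transfer stub_torusCohomologyBasis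

end Summit.HodgeConjecture.HodgeConjecture.Cruxes.RiemannWeightOne.Birth

end
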